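import Literature.NumberTheory.Rogawski1990.AdelicStableOrbitalCentralH
import Literature.NumberTheory.Rogawski1990.AdelicStableConjugacy
import Literature.NumberTheory.Rogawski1990.KottwitzSignCM
import Literature.NumberTheory.Automorphic.UnitaryGroupOrbitalMeasureFamilyOfLocal
import HarnessLib

/-!
# The SIGNED archimedean stable orbital integral at a CENTRAL rational point is «mass × value»; the central instances of the singular
# archimedean inner-transfer identity (ST-∞) from central masses one and equal central values (Rogawski (1990), §4.1 (4.1.2) p. 40,
# Prop. 10.1.2 (b) p. 146, §14.5 p. 239; Deitmar–Echterhoff (2014), Thm. 1.5.3)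

Topic `NumberTheory/Rogawski1990`; namespace `Literature.NumberTheory.Rogawski1990`.  THEOREMS ONLY (no definition, no named fact, no instance,
no notation, no `sorry`).  Cell `pub/hodgecm-mathlib`, ENGINE T1 (crux H413 = `stmt-HodgeConjecture-24833`), the «#88 side» (pay-down of ★
`SingularEllipticTransferCanonical`, LEAD DESK WORDS T6-18∕T6-20): the (ST-∞) conjunct of the fact (`SingularEllipticTransferCanonical.lean` :379–390)
quantifies over every rational `γ₀ ↔ γ` killed by `(X − e₁)(X − e₂)`, `e₁ ≠ e₂` — the split-singular classes AND the central ones `γ₀ = ζ•1`.  At a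
central point both archimedean stable classes are singletons, both Kottwitz signs are `+1` and the orbital integral is the point mass times the value,
so the central instances are bookkeeping: they follow from «central archimedean masses one» (the (C1) rider of the T6-L5 letter S1, for BOTH singular
archimedean members `mGis`, `mqis`) and «equal central values» (conjunct (S-d) of ★ `ArchCanonicalSingularMatrix`).  This file proves exactly that, so a
later edition of the line can restrict the (ST-∞) LETTER to the non-central split-singular classes (count-neutral, thinner letter).

* §1 (any group, any «stable conjugacy» relation `st`) `stableOrbitalIntegralRel_of_forall_comm` — if `γ` is central and `st γ y → y = γ`, then
  `Φ^{st}_m(γ, f) = (m ⟦γ⟧)(univ) · f(γ)` (the summation set is `{⟦γ⟧}`, ★ `classOrbitalIntegral_mk_of_forall_comm`).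
* §2 (the CM archimedean carriers, any `N`, `H`) `kottwitzSignArchWeight_mk_eq_one_of_coe_eq_smul_one` (`e_∞(⟦ζ•1 ⊗ 1⟧) = 1`, ★ `kottwitzSign_smul_one`
  coordinate by coordinate), `archStableOrbitalIntegral_of_coe_eq_smul_one`, `archStableOrbitalIntegral_signed_of_coe_eq_smul_one`
  (`Φ^{st}_m(e_∞·a)(ζ•1 ⊗ 1) = (m ⟦ζ•1 ⊗ 1⟧)(univ) · a(ζ•1 ⊗ 1)`), and the mass bridge `OrbitalMeasureFamily.atPoint_univ` (`(m.atPoint x)(univ) = (m ⟦x⟧)(univ)`).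
* §3 (`N = 3`, the inner form `H′` and the quasi-split `Φ₃`) `archStableOrbitalIntegral_signed_eq_of_central` — THE CENTRAL INSTANCE OF (ST-∞): for rational
  `γ₀ = ζ•1 ∈ U(H′)(L⁺)` and `γ ∈ U(Φ₃)(L⁺)` with `γ₀ ↔ γ` (then `γ = ζ•1`), archimedean members `mGis`, `mqis` with central masses one in the (C1) shape, and
  functions with `a (γ ⊗ 1) = a′ (γ₀ ⊗ 1)` (the (S-d) value clause): the (ST-∞) equation holds VERBATIM.
* §4 (ED. 2) `conjClasses_eq_of_stableClass_eq_of_coe_eq_smul_one` (a stable class with scalar representative is ONE class ⇒ (K7-s)@central is `c = c′`),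
  `isNormalisedOff_empty_of_forall_comm_of_atPoint_univ_eq_one`, `exists_isNormalisedOff_of_coe_eq_smul_one_of_atPoint_univ_eq_one` ((NORM)@central ⟸ (C1)).
HONEST LABEL: HC_CM is proved only modulo the printed citations until rung 0 closes; this file proves no printed citation (the split-singular instances of
(ST-∞) — [Rogawski1990 Lemma 14.5.2 (b); Kottwitz1988 Prop. 2] — stay a letter).

## References
* [Rogawski1990] J. D. Rogawski, *Automorphic Representations of Unitary Groups in Three Variables*, Ann. of Math. Stud. 123 (1990): §4.1 (4.1.2)
  pp. 39–40 (`e(z·1) = 1`), Prop. 10.1.2 (b) p. 146 (`Φ(ζ, f) = f(ζ)`), §14.5 p. 239 (`f′_v(γ₀) = f_v(γ₀)` at central `γ₀`), Lemma 14.5.2 (b) p. 238.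
* [DeitmarEchterhoff2014] A. Deitmar, S. Echterhoff, *Principles of Harmonic Analysis*, 2nd ed. (2014), Thm. 1.5.3.
-/

set_option autoImplicit false

noncomputable section

open MeasureTheory Measure NumberField
open Literature.NumberTheory.Automorphic
open Literature.AlgebraicGeometry.ShimuraVarieties (unitaryGroup)
open scoped Matrix MatrixGroups

/-! ## §1 Generic: the stable orbital integral at a central point whose stable class is a singleton -/

namespace Literature.NumberTheory.Rogawski1990

section Generic

variable {G : Type*} [Group G] [∀ g : G, MeasurableSpace (G ⧸ Subgroup.centralizer ({g} : Set G))]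

/-- **`Φ^{st}_m(γ, f) = (m ⟦γ⟧)(univ) · f(γ)` at a CENTRAL `γ` alone in its `st`-class**: the summation set `{c | st γ (out c)}` of
★ `stableOrbitalIntegralRel` is `{⟦γ⟧}` and the class orbital integral at a central class is mass × value (★ `classOrbitalIntegral_mk_of_forall_comm`).
[cite: Rogawski1990, Prop. 10.1.2 (b) p. 146] [cite: DeitmarEchterhoff2014, Thm. 1.5.3] -/
theorem stableOrbitalIntegralRel_of_forall_comm (st : G → G → Prop) (m : OrbitalMeasureFamily G) (f : G → ℂ) {γ : G}
    (hγ : ∀ g : G, g * γ = γ * g) (hst : ∀ y : G, st γ y → y = γ) (hrefl : st γ γ) :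
    stableOrbitalIntegralRel st m f γ = ((m (ConjClasses.mk γ)) Set.univ).toReal * f γ := by
  have hset : {c : ConjClasses G | st γ (Quotient.out c)} = {ConjClasses.mk γ} := by
    ext c
    simp only [Set.mem_setOf_eq, Set.mem_singleton_iff]
    constructor
    · intro h
      rw [← Quotient.out_eq c]
      show ConjClasses.mk (Quotient.out c) = ConjClasses.mk γ
      rw [hst _ h]
    · rintro rfl
      rw [quotientOut_conjClassesMk_eq_of_forall_comm hγ]
      exact hrefl
  rw [stableOrbitalIntegralRel_def, hset, finsum_mem_singleton, classOrbitalIntegral_mk_of_forall_comm hγ m f, Complex.real_smul]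

end Generic

/-! ## §2 The CM archimedean carriers: signs and signed stable orbital integrals at `ζ•1 ⊗ 1` -/

section Arch

variable {L : Type} [Field L] [NumberField L] [IsCMField L] {N : ℕ} {H : Matrix (Fin N) (Fin N) L}

omit [IsCMField L] in
/-- A scalar matrix stays scalar under an entrywise ring map. [folklore] -/
private theorem smul_one_map' {R S : Type*} [CommRing R] [CommRing S] (φ : R →+* S) (r : R) :
    (r • (1 : Matrix (Fin N) (Fin N) R)).map φ = φ r • (1 : Matrix (Fin N) (Fin N) S) := by
  rw [Matrix.smul_one_eq_diagonal, Matrix.diagonal_map (map_zero φ), Matrix.smul_one_eq_diagonal]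

/-- **`e_∞(⟦γ ⊗ 1⟧) = 1` at a CENTRAL rational `γ = ζ•1`**: every coordinate `(γ ⊗ 1)_w` is the scalar `w(ζ)•1`, whose Kottwitz sign is `+1`
(★ `kottwitzSign_smul_one`; ★ `kottwitzSignArch_mk`). [cite: Rogawski1990, §4.1 (4.1.2) p. 40] -/
theorem kottwitzSignArchWeight_mk_eq_one_of_coe_eq_smul_one [NeZero N] {γ : (UnitaryGroup.cmDatum L N H).Rational} {ζ : L}
    (hγ : (((γ : unitaryGroup (cmConjRingHom L) H).val : GL (Fin N) L) : Matrix (Fin N) (Fin N) L) = ζ • (1 : Matrix (Fin N) (Fin N) L)) :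
    kottwitzSignArchWeight L N H (ConjClasses.mk (cmRationalToArch L N H γ)) = 1 := by
  classical
  unfold kottwitzSignArchWeight
  rw [kottwitzSignArch_mk]
  have h1 : ∀ w : {w : InfinitePlace L // InfinitePlace.IsComplex w}, kottwitzSignAt L N H w (cmRationalToArch L N H γ) = 1 := by
    intro w
    unfold kottwitzSignAt
    rw [coe_coe_cmRationalToArch_eq_smul_one_of_smul_one hγ, smul_one_map']
    exact kottwitzSign_smul_one _ _ _
  rw [Finset.prod_eq_one fun w _ => h1 w]
  simp

variable [∀ g : ↥(UnitaryGroup.arch (↥(maximalRealSubfield L)) L (IsCMField.complexConj L) N H),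
    MeasurableSpace (↥(UnitaryGroup.arch (↥(maximalRealSubfield L)) L (IsCMField.complexConj L) N H) ⧸
      Subgroup.centralizer ({g} : Set ↥(UnitaryGroup.arch (↥(maximalRealSubfield L)) L (IsCMField.complexConj L) N H)))]

/-- **`Φ^st_m(a)(γ ⊗ 1) = (m ⟦γ ⊗ 1⟧)(univ) · a(γ ⊗ 1)` at a CENTRAL rational `γ = ζ•1`** (archimedean stable conjugacy = conjugacy in `GL_N(L ⊗ ℝ)`, so the
stable class of the scalar `γ ⊗ 1` is `{⟦γ ⊗ 1⟧}`: ★ `eq_of_isStablyConj_of_coe_eq_smul_one`, ★ `cmRationalToArch_comm_of_smul_one`; §1).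
[cite: Rogawski1990, Prop. 10.1.2 (b) p. 146; §4.1 (4.1.1) p. 39] -/
theorem archStableOrbitalIntegral_of_coe_eq_smul_one {γ : (UnitaryGroup.cmDatum L N H).Rational} {ζ : L}
    (hγ : (((γ : unitaryGroup (cmConjRingHom L) H).val : GL (Fin N) L) : Matrix (Fin N) (Fin N) L) = ζ • (1 : Matrix (Fin N) (Fin N) L))
    (m : OrbitalMeasureFamily ↥(UnitaryGroup.arch (↥(maximalRealSubfield L)) L (IsCMField.complexConj L) N H))
    (a : ↥(UnitaryGroup.arch (↥(maximalRealSubfield L)) L (IsCMField.complexConj L) N H) → ℂ) :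
    archStableOrbitalIntegral L N H m a (cmRationalToArch L N H γ) =
      ((m (ConjClasses.mk (cmRationalToArch L N H γ))) Set.univ).toReal * a (cmRationalToArch L N H γ) :=
  stableOrbitalIntegralRel_of_forall_comm _ m a (cmRationalToArch_comm_of_smul_one hγ)
    (fun _ h => (eq_of_isStablyConj_of_coe_eq_smul_one (coe_coe_cmRationalToArch_eq_smul_one_of_smul_one hγ) h).symm)
    (IsStablyConj.refl _)

/-- **The SIGNED version**: `Φ^st_m(e_∞·a)(γ ⊗ 1) = (m ⟦γ ⊗ 1⟧)(univ) · a(γ ⊗ 1)` at a central rational `γ = ζ•1` (the sign at the one class is `+1`).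
[cite: Rogawski1990, §4.1 (4.1.2) p. 40; Prop. 10.1.2 (b) p. 146] -/
theorem archStableOrbitalIntegral_signed_of_coe_eq_smul_one [NeZero N] {γ : (UnitaryGroup.cmDatum L N H).Rational} {ζ : L}
    (hγ : (((γ : unitaryGroup (cmConjRingHom L) H).val : GL (Fin N) L) : Matrix (Fin N) (Fin N) L) = ζ • (1 : Matrix (Fin N) (Fin N) L))
    (m : OrbitalMeasureFamily ↥(UnitaryGroup.arch (↥(maximalRealSubfield L)) L (IsCMField.complexConj L) N H))
    (a : ↥(UnitaryGroup.arch (↥(maximalRealSubfield L)) L (IsCMField.complexConj L) N H) → ℂ) :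
    archStableOrbitalIntegral L N H m (fun x => kottwitzSignArchWeight L N H (ConjClasses.mk x) * a x) (cmRationalToArch L N H γ) =
      ((m (ConjClasses.mk (cmRationalToArch L N H γ))) Set.univ).toReal * a (cmRationalToArch L N H γ) := by
  rw [archStableOrbitalIntegral_of_coe_eq_smul_one hγ, kottwitzSignArchWeight_mk_eq_one_of_coe_eq_smul_one hγ, one_mul]

omit [IsCMField L] in
/-- **Mass bridge** `(m.atPoint x)(univ) = (m ⟦x⟧)(univ)` for ANY class-indexed family on a topological group with Borel orbit quotients (★
`OrbitalMeasureFamily.atPoint` is the push-forward along the measurable `cosetCongr`). [cite: DeitmarEchterhoff2014, Thm. 1.5.3] -/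
theorem _root_.Literature.NumberTheory.Automorphic.OrbitalMeasureFamily.atPoint_univ {G : Type*} [Group G] [TopologicalSpace G] [IsTopologicalGroup G]
    [∀ g : G, MeasurableSpace (G ⧸ Subgroup.centralizer ({g} : Set G))] [∀ g : G, BorelSpace (G ⧸ Subgroup.centralizer ({g} : Set G))]
    (m : OrbitalMeasureFamily G) (x : G) : m.atPoint x Set.univ = m (ConjClasses.mk x) Set.univ := by
  unfold OrbitalMeasureFamily.atPoint
  rw [Measure.map_apply (Literature.MeasureTheory.Group.continuous_cosetCongr _ _ _ _ (continuous_mulAutConj _)).measurable MeasurableSet.univ,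
    Set.preimage_univ]

end Arch

/-! ## §3 `N = 3`: the CENTRAL instances of (ST-∞) from central masses one and equal central values -/

section Central

variable (L : Type) [Field L] [NumberField L] [IsCMField L] (H' : Matrix (Fin 3) (Fin 3) L)

/-- **Rational correspondence TO A SCALAR is equality of matrices**: `γ₀ = ζ•1 ∈ U(H′)(L⁺)` and `γ₀ ↔ γ` (`GL₃(L)`-conjugate) force `γ = ζ•1`.
[cite: Rogawski1990, §3.1 p. 19; §14.1 p. 232] -/
theorem coe_eq_smul_one_of_corresponds_of_coe_eq_smul_one {γ₀ : (UnitaryGroup.cmDatum L 3 H').Rational}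
    {γ : (UnitaryGroup.cmDatum L 3 (Matrix.of fun i j : Fin 3 => if i.val + j.val + 1 = 3 then (1 : L) else 0)).Rational} {ζ : L}
    (hγ₀ : (((γ₀ : unitaryGroup (cmConjRingHom L) H').val : GL (Fin 3) L) : Matrix (Fin 3) (Fin 3) L) = ζ • (1 : Matrix (Fin 3) (Fin 3) L))
    (hc : Corresponds (cmConjRingHom L) H' (Matrix.of fun i j : Fin 3 => if i.val + j.val + 1 = 3 then (1 : L) else 0)
      (γ₀ : unitaryGroup (cmConjRingHom L) H') (γ : unitaryGroup (cmConjRingHom L) (Matrix.of fun i j : Fin 3 => if i.val + j.val + 1 = 3 then (1 : L) else 0))) :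
    (((γ : unitaryGroup (cmConjRingHom L) (Matrix.of fun i j : Fin 3 => if i.val + j.val + 1 = 3 then (1 : L) else 0)).val : GL (Fin 3) L) :
        Matrix (Fin 3) (Fin 3) L) = ζ • (1 : Matrix (Fin 3) (Fin 3) L) := by
  obtain ⟨g, hg⟩ := isConj_iff.1 hc
  have h : ((γ : unitaryGroup (cmConjRingHom L) (Matrix.of fun i j : Fin 3 => if i.val + j.val + 1 = 3 then (1 : L) else 0)).val : GL (Fin 3) L) =
      ((γ₀ : unitaryGroup (cmConjRingHom L) H').val : GL (Fin 3) L) := by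
    rw [← hg, commute_of_coe_eq_smul_one hγ₀ g, mul_inv_cancel_right]
  rw [h, hγ₀]

variable
  [∀ g : ↥(UnitaryGroup.arch (↥(maximalRealSubfield L)) L (IsCMField.complexConj L) 3 H'),
    MeasurableSpace (↥(UnitaryGroup.arch (↥(maximalRealSubfield L)) L (IsCMField.complexConj L) 3 H') ⧸
      Subgroup.centralizer ({g} : Set ↥(UnitaryGroup.arch (↥(maximalRealSubfield L)) L (IsCMField.complexConj L) 3 H')))]
  [∀ g : ↥(UnitaryGroup.arch (↥(maximalRealSubfield L)) L (IsCMField.complexConj L) 3 H'),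
    BorelSpace (↥(UnitaryGroup.arch (↥(maximalRealSubfield L)) L (IsCMField.complexConj L) 3 H') ⧸
      Subgroup.centralizer ({g} : Set ↥(UnitaryGroup.arch (↥(maximalRealSubfield L)) L (IsCMField.complexConj L) 3 H')))]
  [∀ g : ↥(UnitaryGroup.arch (↥(maximalRealSubfield L)) L (IsCMField.complexConj L) 3 (Matrix.of fun i j : Fin 3 => if i.val + j.val + 1 = 3 then (1 : L) else 0)),
    MeasurableSpace (↥(UnitaryGroup.arch (↥(maximalRealSubfield L)) L (IsCMField.complexConj L) 3 (Matrix.of fun i j : Fin 3 => if i.val + j.val + 1 = 3 then (1 : L) else 0)) ⧸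
      Subgroup.centralizer ({g} : Set ↥(UnitaryGroup.arch (↥(maximalRealSubfield L)) L (IsCMField.complexConj L) 3 (Matrix.of fun i j : Fin 3 => if i.val + j.val + 1 = 3 then (1 : L) else 0))))]
  [∀ g : ↥(UnitaryGroup.arch (↥(maximalRealSubfield L)) L (IsCMField.complexConj L) 3 (Matrix.of fun i j : Fin 3 => if i.val + j.val + 1 = 3 then (1 : L) else 0)),
    BorelSpace (↥(UnitaryGroup.arch (↥(maximalRealSubfield L)) L (IsCMField.complexConj L) 3 (Matrix.of fun i j : Fin 3 => if i.val + j.val + 1 = 3 then (1 : L) else 0)) ⧸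
      Subgroup.centralizer ({g} : Set ↥(UnitaryGroup.arch (↥(maximalRealSubfield L)) L (IsCMField.complexConj L) 3 (Matrix.of fun i j : Fin 3 => if i.val + j.val + 1 = 3 then (1 : L) else 0))))]

/-- **THE CENTRAL INSTANCES OF (ST-∞).**  `H′` any form, `Φ₃` the quasi-split form; archimedean class-indexed families `mGis` on `G′_∞ = U(H′)(L⁺ ⊗ ℝ)` and
`mqis` on `G_∞ = U(Φ₃)(L⁺ ⊗ ℝ)` whose masses at the central rational points are ONE, in the shape of the (C1) rider of the T6-L5 letter S1 (`atPoint` at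
`archPart (out c ⊗ 1)` for every rational class `c` with scalar representative) on BOTH sides; functions `a′`, `a` taking the SAME value at `γ ⊗ 1` and
`γ₀ ⊗ 1` (conjunct (S-d) of ★ `ArchCanonicalSingularMatrix` delivers this for smooth inner-transfer pairs); a central rational `γ₀ = ζ•1 ↔ γ`.  THEN the (ST-∞)
equation of ★ `SingularEllipticTransferCanonical` (:386–390) holds at `(γ₀, γ)`: both sides equal `a′(γ₀ ⊗ 1) = a(γ ⊗ 1)` (§2 + ★ `archPart_cmDatum_toAdelic` +
`atPoint_univ`).  No smoothness, transfer or measure hypothesis beyond the two central masses is used. [cite: Rogawski1990, §14.5 p. 239; Prop. 10.1.2 (b) p. 146; §4.1 (4.1.2) p. 40] -/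
theorem archStableOrbitalIntegral_signed_eq_of_central
    (mGis : OrbitalMeasureFamily ↥(UnitaryGroup.arch (↥(maximalRealSubfield L)) L (IsCMField.complexConj L) 3 H'))
    (mqis : OrbitalMeasureFamily ↥(UnitaryGroup.arch (↥(maximalRealSubfield L)) L (IsCMField.complexConj L) 3 (Matrix.of fun i j : Fin 3 => if i.val + j.val + 1 = 3 then (1 : L) else 0)))
    -- (C1), archimedean half, `G′` side: mass one at every central rational class
    (hC1' : ∀ c : ConjClasses (UnitaryGroup.cmDatum L 3 H').Rational,
      (∃ ζ : L, (((Quotient.out c).val : GL (Fin 3) L) : Matrix (Fin 3) (Fin 3) L) = ζ • (1 : Matrix (Fin 3) (Fin 3) L)) →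
      mGis.atPoint (UnitaryGroup.archPart (↥(maximalRealSubfield L)) L (IsCMField.complexConj L) 3 H' ((UnitaryGroup.cmDatum L 3 H').toAdelic (Quotient.out c))) Set.univ = 1)
    -- (C1-q), archimedean half, quasi-split side
    (hC1 : ∀ c : ConjClasses (UnitaryGroup.cmDatum L 3 (Matrix.of fun i j : Fin 3 => if i.val + j.val + 1 = 3 then (1 : L) else 0)).Rational,
      (∃ ζ : L, (((Quotient.out c).val : GL (Fin 3) L) : Matrix (Fin 3) (Fin 3) L) = ζ • (1 : Matrix (Fin 3) (Fin 3) L)) →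
      mqis.atPoint (UnitaryGroup.archPart (↥(maximalRealSubfield L)) L (IsCMField.complexConj L) 3 (Matrix.of fun i j : Fin 3 => if i.val + j.val + 1 = 3 then (1 : L) else 0)
        ((UnitaryGroup.cmDatum L 3 (Matrix.of fun i j : Fin 3 => if i.val + j.val + 1 = 3 then (1 : L) else 0)).toAdelic (Quotient.out c))) Set.univ = 1)
    (a' : ↥(UnitaryGroup.arch (↥(maximalRealSubfield L)) L (IsCMField.complexConj L) 3 H') → ℂ)
    (a : ↥(UnitaryGroup.arch (↥(maximalRealSubfield L)) L (IsCMField.complexConj L) 3 (Matrix.of fun i j : Fin 3 => if i.val + j.val + 1 = 3 then (1 : L) else 0)) → ℂ)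
    (γ₀ : (UnitaryGroup.cmDatum L 3 H').Rational)
    (γ : (UnitaryGroup.cmDatum L 3 (Matrix.of fun i j : Fin 3 => if i.val + j.val + 1 = 3 then (1 : L) else 0)).Rational) {ζ : L}
    (hγ₀ : (((γ₀ : unitaryGroup (cmConjRingHom L) H').val : GL (Fin 3) L) : Matrix (Fin 3) (Fin 3) L) = ζ • (1 : Matrix (Fin 3) (Fin 3) L))
    (hcorr : Corresponds (cmConjRingHom L) H' (Matrix.of fun i j : Fin 3 => if i.val + j.val + 1 = 3 then (1 : L) else 0)
      (γ₀ : unitaryGroup (cmConjRingHom L) H') (γ : unitaryGroup (cmConjRingHom L) (Matrix.of fun i j : Fin 3 => if i.val + j.val + 1 = 3 then (1 : L) else 0)))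
    -- (S-d)'s conclusion at `(γ₀, γ, ζ)`
    (hSd : a (cmRationalToArch L 3 (Matrix.of fun i j : Fin 3 => if i.val + j.val + 1 = 3 then (1 : L) else 0) γ) = a' (cmRationalToArch L 3 H' γ₀)) :
    archStableOrbitalIntegral L 3 H' mGis (fun x => kottwitzSignArchWeight L 3 H' (ConjClasses.mk x) * a' x) (cmRationalToArch L 3 H' γ₀) =
      archStableOrbitalIntegral L 3 (Matrix.of fun i j : Fin 3 => if i.val + j.val + 1 = 3 then (1 : L) else 0) mqis
        (fun x => kottwitzSignArchWeight L 3 (Matrix.of fun i j : Fin 3 => if i.val + j.val + 1 = 3 then (1 : L) else 0) (ConjClasses.mk x) * a x)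
        (cmRationalToArch L 3 (Matrix.of fun i j : Fin 3 => if i.val + j.val + 1 = 3 then (1 : L) else 0) γ) := by
  have hγ : (((γ : unitaryGroup (cmConjRingHom L) (Matrix.of fun i j : Fin 3 => if i.val + j.val + 1 = 3 then (1 : L) else 0)).val : GL (Fin 3) L) :
      Matrix (Fin 3) (Fin 3) L) = ζ • (1 : Matrix (Fin 3) (Fin 3) L) :=
    coe_eq_smul_one_of_corresponds_of_coe_eq_smul_one L H' hγ₀ hcorr
  -- the two central masses at `γ₀ ⊗ 1`, `γ ⊗ 1`, read through `out ⟦·⟧ = ·` (central), ★ `archPart_cmDatum_toAdelic` and `atPoint_univ`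
  have hcen₀ : ∀ g : (UnitaryGroup.cmDatum L 3 H').Rational, g * γ₀ = γ₀ * g :=
    fun g => Subtype.ext (commute_of_coe_eq_smul_one hγ₀ (g : unitaryGroup (cmConjRingHom L) H').val)
  have hcen : ∀ g : (UnitaryGroup.cmDatum L 3 (Matrix.of fun i j : Fin 3 => if i.val + j.val + 1 = 3 then (1 : L) else 0)).Rational, g * γ = γ * g :=
    fun g => Subtype.ext (commute_of_coe_eq_smul_one hγ
      (g : unitaryGroup (cmConjRingHom L) (Matrix.of fun i j : Fin 3 => if i.val + j.val + 1 = 3 then (1 : L) else 0)).val)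
  have hout₀ := quotientOut_conjClassesMk_eq_of_forall_comm hcen₀
  have hout := quotientOut_conjClassesMk_eq_of_forall_comm hcen
  have hm₀ : (mGis (ConjClasses.mk (cmRationalToArch L 3 H' γ₀))) Set.univ = 1 := by
    have h := hC1' (ConjClasses.mk γ₀) ⟨ζ, by rw [hout₀]; exact hγ₀⟩
    rwa [hout₀, archPart_cmDatum_toAdelic, OrbitalMeasureFamily.atPoint_univ] at h
  have hm : (mqis (ConjClasses.mk (cmRationalToArch L 3 (Matrix.of fun i j : Fin 3 => if i.val + j.val + 1 = 3 then (1 : L) else 0) γ))) Set.univ = 1 := by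
    have h := hC1 (ConjClasses.mk γ) ⟨ζ, by rw [hout]; exact hγ⟩
    rwa [hout, archPart_cmDatum_toAdelic, OrbitalMeasureFamily.atPoint_univ] at h
  rw [archStableOrbitalIntegral_signed_of_coe_eq_smul_one hγ₀, archStableOrbitalIntegral_signed_of_coe_eq_smul_one hγ, hm₀, hm, hSd]

end Central

/-! ## §4 (ED. 2) The other two identity riders at the CENTRAL classes are bookkeeping too: (K7-s)@central is `c = c′`, (NORM)@central ⟸ (C1) -/

section CentralRiders

/-- **A stable class with a SCALAR representative is a single conjugacy class**: if `out c = r•1` and `𝒪_st(c) = 𝒪_st(c′)` then `c = c′` (stable conjugacy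
to a scalar is equality, ★ `eq_of_isStablyConj_of_coe_eq_smul_one`).  Hence the (K7-s) covolume clause of ★ `SingularEllipticTransferCanonical` is
TRIVIAL at the central classes (after `subst`, both sides coincide) — only its split-singular instances are a letter. [cite: Rogawski1990, §3.1 p. 19; §14.5 p. 239] -/
theorem conjClasses_eq_of_stableClass_eq_of_coe_eq_smul_one {R : Type*} [CommRing R] {n : Type*} [Fintype n] [DecidableEq n] {σ : R →+* R}
    {J : Matrix n n R} {c c' : ConjClasses ↥(unitaryGroup σ J)} {r : R}
    (hc : (((Quotient.out c : ↥(unitaryGroup σ J)) : GL n R) : Matrix n n R) = r • (1 : Matrix n n R))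
    (h : StableClass.ofConjClass c = StableClass.ofConjClass c') : c = c' := by
  rw [← Quotient.out_eq c, ← Quotient.out_eq c'] at h
  change StableClass.ofConjClass (ConjClasses.mk (Quotient.out c)) = StableClass.ofConjClass (ConjClasses.mk (Quotient.out c')) at h
  rw [StableClass.ofConjClass_mk, StableClass.ofConjClass_mk, stableClassOf_eq_iff] at h
  rw [← Quotient.out_eq c, ← Quotient.out_eq c']
  change ConjClasses.mk (Quotient.out c) = ConjClasses.mk (Quotient.out c')
  rw [eq_of_isStablyConj_of_coe_eq_smul_one hc h]

variable (L : Type) [Field L] [NumberField L] [IsCMField L] (N : ℕ) (H : Matrix (Fin N) (Fin N) L)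
  [∀ (v : IsDedekindDomain.HeightOneSpectrum (𝓞 ↥(maximalRealSubfield L))) (x : (UnitaryGroup.cmDatum L N H).Local v),
    MeasurableSpace ((UnitaryGroup.cmDatum L N H).Local v ⧸ Subgroup.centralizer ({x} : Set ((UnitaryGroup.cmDatum L N H).Local v)))]
  (mG : ∀ v : IsDedekindDomain.HeightOneSpectrum (𝓞 ↥(maximalRealSubfield L)), OrbitalMeasureFamily ((UnitaryGroup.cmDatum L N H).Local v))

/-- **Mass one at a central point IS normalisation there, with EMPTY exceptional set**: if every `g_v` is central in `U(H)(L⁺_v)` and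
`(mG v).atPoint g_v` has total mass `1`, then ★ `IsNormalisedOff L N H mG g ∅` (the orbit space is one point, and the image of `U(H)(𝒪_v)` is all of it —
converse of ★ `atPoint_toLocal_univ_eq_one_of_forall_comm`). [cite: Rogawski1990, §4.3 p. 44; Prop. 10.1.2 (b) p. 146] -/
theorem isNormalisedOff_empty_of_forall_comm_of_atPoint_univ_eq_one (g : (UnitaryGroup.cmDatum L N H).Adelic)
    (hcen : ∀ (v : IsDedekindDomain.HeightOneSpectrum (𝓞 ↥(maximalRealSubfield L))) (x : (UnitaryGroup.cmDatum L N H).Local v),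
      x * (UnitaryGroup.cmDatum L N H).toLocal v g = (UnitaryGroup.cmDatum L N H).toLocal v g * x)
    (h1 : ∀ v, (mG v).atPoint ((UnitaryGroup.cmDatum L N H).toLocal v g) Set.univ = 1) :
    UnitaryGroup.IsNormalisedOff L N H mG g ∅ := by
  intro v _
  haveI := subsingleton_quotient_centralizer_of_forall_comm (hcen v)
  have huniv : ((QuotientGroup.mk : (UnitaryGroup.cmDatum L N H).Local v → (UnitaryGroup.cmDatum L N H).Local v ⧸
        Subgroup.centralizer ({(UnitaryGroup.cmDatum L N H).toLocal v g} : Set ((UnitaryGroup.cmDatum L N H).Local v))) ''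
      (UnitaryGroup.cmLocalIntegralLevel L N H v : Set ((UnitaryGroup.cmDatum L N H).Local v))) = Set.univ :=
    Set.eq_univ_of_forall fun y => ⟨1, one_mem _, Subsingleton.elim _ _⟩
  rw [huniv]
  exact h1 v

/-- **(NORM) at a CENTRAL rational `γ₀ = ζ•1` from the (C1) local masses**: `∃ S₀, IsNormalisedOff L N H mG (γ₀ ⊗ 1) S₀` (namely `S₀ = ∅`) as soon as
`(mG v).atPoint ((γ₀ ⊗ 1)_v)` has mass `1` at every `v` — the (C1) rider of the T6-L5 letter S1 read at the class `⟦γ₀⟧` (`out ⟦γ₀⟧ = γ₀`, central).  So the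
(NORM) conjunct of ★ `SingularEllipticTransferCanonical` needs a letter only at the split-singular non-central `γ₀`. [cite: Rogawski1990, §4.3 p. 44; Prop. 10.1.2 (b) p. 146] -/
theorem exists_isNormalisedOff_of_coe_eq_smul_one_of_atPoint_univ_eq_one {γ₀ : (UnitaryGroup.cmDatum L N H).Rational} {ζ : L}
    (hγ₀ : (((γ₀ : unitaryGroup (cmConjRingHom L) H).val : GL (Fin N) L) : Matrix (Fin N) (Fin N) L) = ζ • (1 : Matrix (Fin N) (Fin N) L))
    (h1 : ∀ v, (mG v).atPoint ((UnitaryGroup.cmDatum L N H).toLocal v ((UnitaryGroup.cmDatum L N H).toAdelic γ₀)) Set.univ = 1) :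
    ∃ S₀ : Finset (IsDedekindDomain.HeightOneSpectrum (𝓞 ↥(maximalRealSubfield L))), UnitaryGroup.IsNormalisedOff L N H mG ((UnitaryGroup.cmDatum L N H).toAdelic γ₀) S₀ :=
  ⟨∅, isNormalisedOff_empty_of_forall_comm_of_atPoint_univ_eq_one L N H mG _ (fun v x => cmDatum_toLocal_toAdelic_comm_of_smul_one hγ₀ v x) h1⟩

end CentralRiders

end Literature.NumberTheory.Rogawski1990

end
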